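import Literature.MathematicalPhysics.QuantumFieldTheory.Balaban1983to89.B9Eq3105FamThreeCover
import Literature.MathematicalPhysics.QuantumFieldTheory.Balaban1983to89.B9Cor36BondSandwichTransferSrc
import Literature.MathematicalPhysics.QuantumFieldTheory.Balaban1983to89.B9Cor36GCubeLocDefectCover

/-!
# `Balaban1983to89.B9Eq3105FamThreeTFar` — THE TRANSPOSED (`hV′`) FAMILY 3 OF (3.105), `h_□O_□h_□·ζ_□̃(DPD* − DP_□D*)`: THE LOCATED DIFFERENCE
# `h_□·(DPD*(U₁) − Pl_□)` HAS GLOBAL SOURCES — SPLIT ITS COLUMNS BY `ζ_□̃` ITSELF; THE FAR COLUMNS (`1 − ζ_□̃`, separated from `supp h_□` by `D_sep`) ARE SMALL BY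
# SEPARATION ALONE, LETTER BY LETTER, WITH NO DIFFERENCE STRUCTURE; THE NEAR COLUMNS ARE THE BOTH-SIDES-LOCATED WORD OF F3-B AT THE SWAPPED PAIR `(h_□, ζ_□̃)`
# (sub-row G-B9-LETTERS, GAPS G-B9-05∕family 3, programme FAMTHREE FILE F3-D1; lead g34 RULINGS FAMTHREE 2026-08-28 23:38Z ∕ FAMTHREE-2 2026-08-29 00:30Z;
# p33 g103's F3-C `B9Eq3105FamThreeCover` header (iii) names this file «F3-D»; division p38 g47 ∕ p33 g103, HOME∕INBOX 2026-08-29 00:53Z)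

statement-level skeleton of published theorems with citation tags; proofs where landed; nothing here is a claim about the Yang–Mills mass gap

THE PRINTED LOCUS (verbatim, held `paper:balaban1985-cmp99-background-propagators`, journal page = PDF page + 388).  p. 414 (3.105): «Δ_aG₀ = I − Σ_□K(h_□)G_□h_□ −
Σ_□(1 − ζ_□̃)DPD*h_□G_□h_□ − Σ_□ζ_□̃(DPD* − DP_□D*)h_□G_□h_□ − Σ_□ζ_□̃P_{□,1}(∂h_□)G_□h_□ = I − R, where the function ζ_□̃ is defined similarly to h_□, i.e.
ζ_□̃ ∈ C₀^∞(□̃) and ζ_□̃ = 1 on a cube containing □, whose boundary is in a distance ≧ ⅔M to the boundary of □. This implies that supp h_□ is separated from supp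
(1 − ζ_□̃) by a distance ≧ M.»; (3.106) p. 414 «G = G₀(I − R)⁻¹ = Σ_{n=0}^∞ G₀Rⁿ.» (the tree's `hV′` is M5.7's device: the same expansion multiplied from the
right, the remainder read from `|·|₍₋₁₎` to `|·|₍₋₃₎` — not a printed sentence); p. 415 l. 21–24: «The term in the second sum gives rise to small terms in the
expansion because of the overall exponential factor and the fact that localizations introduced by 1 − ζ_□̃ and h_□ are separated by a distance ≧ M. The analysis
is the same as before.»; p. 411 l. 36–41: «The characteristic function 1 − □̃ at the beginning of the term, and the function h_□ at the end, restrict a kernel of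
the term to points separated at least by a distance MLʲη (if □ ∈ 𝒟_j). Hence the part of the exponential factor can be estimated by e^{−(1∕4)δ₀M}»; p. 412
l. 31–36: «can be estimated by the usual factors multiplied by e^{−2δ₀M}; we have to notice only that the operators may differ outside □̃₀, and the distance from
□ to □̃₀ᶜ is at least M»; (3.49) p. 399, with p. 414 l. 5–6 «DP D* has a regular kernel satisfying (3.49)»; Cor. 3.6 p. 408 l. 11–14, p. 409 l. 1–5 (the
cube-sequence operators «satisfy all the inequalities of Theorems 3.1–3.3 correspondingly»);
[4] (2.83)–(2.85) pp. 237–238 (outer variable far from □, inner factor localized at □ ⟹ `e^{−aD}·e^{−ρd}`), (2.51)–(2.55) p. 232, Lemma 2.1 (2.61) p. 234.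

WHY THIS FILE.  M5.7's consumer `B9Thm310DeltaAIsUnitOfExpansion.eBlock_kernelFamilyBInv_GAY_of_localInverseCubes''` displays the TRANSPOSED family 3 in
`hV′` as `Σ_□ conj b((M_{h_□}·O_□(U₁)·M_{h_□}·(M_{ζ_□}·(DPDsY parS G′ (cfg U₁) − Pl □)))^ℝ) ≺ θV′·ℓ(a)·ℓ(a′)⁻¹·e^{−δ₀d}`.  F3-A `famThreeT_word_eq` removes the
`M_ζ` («ζ_□̃h_□ = h_□», p. 415), leaving the located difference `M_{h_□}·(P − Pl_□)` whose ROWS are in `supp h_□` but whose SOURCES ARE GLOBAL — unlike the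
`hrest` word `M_ζ·(P − Pl_□)·M_h` of F3-B∕F3-C, located on both sides.  THIS FILE closes the gap between the two shapes with NO new analysis: insert
`1 = M_{ζ_□̃} + (1 − M_{ζ_□̃})` on the right.  The NEAR part `M_{h_□}·(P − Pl_□)·M_{ζ_□̃}` is located on both sides and IS F3-B's per-cube word at the swapped
pair of cut-offs `(h_□, ζ_□̃)` (p33's `B9Eq3105FamThreeMember.hasMajorant_famThree_located_of_cDiff`, generic in the pair) — displayed here as ONE binder
`hXn` in F3-C's currency.  The FAR part `M_{h_□}·(P − Pl_□)·(1 − M_{ζ_□̃})` needs no difference structure at all: `supp h_□` (blocks of `S_□`) and the rows of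
`1 − ζ_□̃` (blocks outside `S^χ_□ = □̃`) are `D_sep = M∕(2L²)`-separated in the member's distance (p21 `hsep_cover`, p33 `B9Eq3105ZetaY`), so EACH of
`M_{h_□}·P·(1 − M_ζ)` and `M_{h_□}·Pl_□·(1 − M_ζ)` is `O(e^{−a_sep·δ₀·D_sep})` by splitting the kernel's exponential — print's own reason for the second sum,
p. 415 l. 21–24 «localizations introduced by 1 − ζ_□̃ and h_□ are separated by a distance ≧ M».  The member word `P = DPD*(U₁)` has its (3.49)₄ block majorant
on the member carrier (p33 Z2-P `B9Ineq349DPDsYOfEBlock.hasMajorant_conj_DPDsY_of_eBlockInv`, displayed here as `hP` in Z2-core's shape); the cube word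
`Pl_□ = R(u)⁻¹·DP_□D*(Ṽ_□)·R(u)` (G-F2 `locProjBY`) has it on the CUBE carrier (p38 D2a `B9Cor36DPDsCubeAtLocCfg.hasMajorant_conj_DPDsCubeY_at_locCfg`, displayed as
`hPlC`) and is carried to the member's blocks by p38's source-global sandwich transfer α-T `hasMajorant_conj_bond_sandwich_src_global` — the negative weight
`ℓ_□(a)⁻²` is honest there because the row cut-off `h_□` forces the row's cube block to be a member block of the same level (`levCubeY_eq_levY_of_nearH`).

WHAT THIS FILE CERTIFIES (kernel-checked; 0 `def`, 0 `def … : Prop`, 0 sorry; standard axioms only)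

* §1 `mul_eq_mul_cut_add_mul_one_sub` (`M_h·W = M_h·W·M_ζ + M_h·W·(1 − M_ζ)`), `conj_rowcut_split` (the same after `conj b(·^ℝ)`), `conj_rowcut_far_eq`
  (`conj b((M_h·W·(1 − M_ζ))^ℝ) = (mulOp h♭·conj b(W^ℝ))·mulOp(1 − ζ♭)`), `conj_rowcut_eq` (`conj b((M_h·W)^ℝ) = mulOp h♭·conj b(W^ℝ)`).
* §2 (letter-free, any `B9.Geometry`): `hasMajorant_rowInd_of_mulOp` (a leading cut-off supported over `S` puts `𝟙_S(a)` on ANY majorant of `mulOp f·T`),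
  ★ `rowSep_majorant_blk` — `T ≺ 𝟙_S(a)·κ·w(a)·e^{−a_Tδ₀d}`, `|m| ≤ 1` supported over `Z`, `d(S, Z) ≥ D_sep`, `a_sep + ρ ≤ a_T` ⟹
  `T·mulOp m ≺ 𝟙_S(a)·(κ·e^{−a_sep·δ₀·D_sep})·w(a)·e^{−ρδ₀d}` (no (2.61), no middle variable: `hasMajorant_mul_mulOp_right` + the exponential split).
* §3 (def-Y's member carrier `(toB6 (geo9K i) Rr Hp, ιB∘blkV1)`, per cube, at the ζ of record `zetaY`): `len_cube_eq_len_member_of_rowInd` (under the row indicator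
  the cube block's (3.41) length IS the member block's), ★★ `hasMajorant_far_P` (`conj b((M_{h_□}·P·(1 − M_{ζ_□̃}))^ℝ) ≺ 𝟙[a ∈ S_□]·(K_P·e^{−a_sep·δ₀·D_sep})·ℓ(a)⁻²·e^{−ρδ₀d}`
  from `hP`), ★★ `hasMajorant_conj_hTY_sandwich_of_cube` (`conj b((M_{h_□}·R(γ)⁻¹·M·R(γ))^ℝ) ≺ (M₂Σ‖b_j‖)²·𝟙^row_□(a)·(K_C·c₁(δ,α))·ℓ(a)⁻²·e^{−(1−α)δd}` from a
  cube-side `conj b(M) ≺ K_C·ℓ_□(a)⁻²·e^{−δd_□}`), ★★ `hasMajorant_far_locProjBY` (the same for `Pl_□ = locProjBY` times `(1 − M_{ζ_□̃})`, with the separation factor).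
* §4 ★★★ `hasMajorant_famThreeT_located` — THE LOCATED DIFFERENCE WITH GLOBAL SOURCES: from the near binder `hXn : conj b((M_{h_□}·(P − Pl_□)·M_{ζ_□̃})^ℝ) ≺
  K_n·ℓ(a)⁻²·e^{−a_nδ₀d}`, `hP`, the cube datum `hPlC` of `DP_□D*(Ṽ)`, a bi-contractive `u`, (2.61) on the cube geometry at the splitting exponent, and the budgets:
  `conj b((M_{h_□}·(P − locProjBY □ u Ṽ))^ℝ) ≺ K_T·ℓ(a)⁻²·e^{−ρδ₀d}`, `K_T = K_n + (K_P + (M₂Σ‖b_j‖)²K_Cc₁)·e^{−a_sep·δ₀·D_sep}` — F3-C's `hX` currency; F3-D2 sums it;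
  ★★ `hasMajorant_famThreeT_located_gauge` — the same with `DP_□D*(Ṽ^{u⁻¹})` for `Pl_□` (F3-A `locProjBY_eq_DPDsCubeY`, gauge-law `parS`), the letter F3-B is stated in.

HONEST SCOPE ∕ NOT CLAIMED.  DISPLAYED: `hXn` (the both-sides-located word at the swapped pair — p33's F3-B Member §5 at `(ζ, h) := (hTY i □, zetaY i □)`, itself
modulo the located `G′`-difference entries D1 and the `C`-difference word `hT3`, suppliers NONE ∕ F3-B3 — NOT proved or restated here), `hP` (Z2-P §2 at the consumer
level), `hPlC` (D2a at the (3.35) datum), the member and cube (2.61), the numerical budgets.  The column split by `ζ_□̃` and the letter-by-letter treatment of the far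
columns are OURS (print treats the third sum by the random-walk re-expansion of p. 415; its separation sentence p. 415 l. 21–24 is about the SECOND sum — we use the
same geometric fact, «supp h_□ is separated from supp (1 − ζ_□̃) by a distance ≧ M» (p. 414), for the far columns of the third sum's transposed word).  NOT here: the
cover sum, the `O_□` factor, the `ℓ(a)ℓ(a′)⁻¹` currency (file F3-D2 `B9Eq3105FamThreeTCover`); families 2 and 4 (ZETA-2 ∕ FAMFOUR, landed); the smallness `hsmallV`.
Count-neutral; NOT a node discharge; no summit ∕ sub-problem statement is proved; nothing continuum ∕ OS ∕ mass-gap ∕ Clay; YM mass gap NOT proved (Track A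
conditional rung).  No `sorry`, no `axiom`, no `… : Prop` fact, no `instance`, no `notation`, no `def`.  NEW file; nothing landed is modified.  Cell
`lit-balaban`, seat `lit-balaban-p38` gen 47, 2026-08-29; `--supports stmt-QuantumFields-19200` as helper.  Net new unproved facts: 0.

RELATED IN THE TREE, NOT DUPLICATED (searched 2026-08-29: `rg 'famThreeT|rowSep|far_P|far_locProj' Literature/` = F3-A's `famThreeT_word_eq` only): p33 F3-C
`B9Eq3105FamThreeCover` (the `hrest` twin; `conj_famThree_eq` pattern), Z2-core `B9Eq3105FamTwoCore` (`conj_one_sub_cutMulY`, `mem_SQT_of_hBdY_hTY_ne_zero`,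
`geo9K_axioms`), `B9Eq3105ZetaY` (`abs_one_sub_hBdY_zetaY_le_one`, `not_mem_SQbigT_bond`), p21 `B9Thm39CinvAtCover.hsep_cover`, `B9Eq395Small.hasMajorant_mul_mulOp_right`,
r06 `B9Thm39CinvTorusRegular.conj_cutMulY`, p38 α-T `B9Cor36BondSandwichTransferSrc.hasMajorant_conj_bond_sandwich_src_global`, p33 D1∕D3 `B9Cor36GCubeLocDefectTransfer`
(`abs_hBdY_hTY_le_indicator`, `nearH_of_hTY_ne_zero`) ∕ `B9Cor36GCubeLocDefectCover` (`rowInd_le_indicator_QT`), r05∕r03 `B9CubeCoarsening.blkOf_eq_of_cube_blkOf_eq`,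
`B9CubeLettersOpsL0.levCubeY_eq_levY_of_nearH`, `B9CubeGeometryInputs.geoCK_len_blkCubeY`, `B9Cor36SiteSandwichTransfer.geo9K_len_site`, G-F2 `B9Cor36GCubeLocLetter.locProjBY`
— all USED BY NAME.
-/

noncomputable section

namespace Literature.MathematicalPhysics.QuantumFieldTheory.Balaban1983to89.B9Eq3105FamThreeTFar

open NormedSpace Complex
open B6RandomWalk (HasMajorant hasMajorant_mono hasMajorant_add Ineq261 c1_nonneg)
open B9Thm34Ext (toB6)
open B9Thm37Sum (mulOp mulOp_apply)
open B9Eq352DivFormLetters (conj)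
open B9Eq39Adjoint (R)
open B9Eq310Hermitian (norm_R_le norm_R_inv_le)
open B6KLevelCensusIndexV1 (KIdx kGeo)
open B6Cover236MultiLevelBlocks (cubes)
open B6GlobalChartV1 (blkV1)
open B6Geom246MultiLevelBox (blkOf)
open B6Ineq2142KLevelV1 (β)
open B9GeoNormsKLevelV1 (geo9K)
open B9CubeLettersBondOpsL0 (BlkCubeY)
open B9Eq360DeltaPrimeACubeY (blkCubeY blkCubeY_apply)
open B9CubeGeometryInputs (geoCK geoCK_len_blkCubeY)
open B9CubeLettersOpsL0 (levCubeY levCubeY_eq_levY_of_nearH)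
open B9Thm37CubeCoverCommutators (cutMulY cutMulY_apply hTY hTY_apply)
open B9Thm37GpTorusRegularCubes (SQT mem_SQT)
open B9Thm39CinvAtCover (SQbigT DsepT hsep_cover)
open B9Thm39CinvTorusRegular (conj_cutMulY)
open B9Eq395Small (hasMajorant_mul_mulOp_right)
open B9Eq3104CutoffCommutators (hBdY hBdY_apply)
open B9Eq3105AtLetters (DPDsCubeY)
open B9Eq3105ZetaY (zetaY abs_one_sub_hBdY_zetaY_le_one not_mem_SQbigT_bond)
open B9Eq3105FamTwoCore (conj_one_sub_cutMulY mem_SQT_of_hBdY_hTY_ne_zero geo9K_axioms)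
open B9Cor35GCubeInputsAtOne (blkBK)
open B9Cor36SiteSandwichTransfer (geo9K_len_site)
open B9Cor36BondSandwichTransferSrc (hasMajorant_conj_bond_sandwich_src_global)
open B9Cor36GCubeLocLetter (locProjBY)
open B9Eq3105FamThreeLetters (locProjBY_eq_DPDsCubeY)
open B9Cor36GCubeLocDefectTransfer (abs_hBdY_hTY_le_indicator nearH_of_hTY_ne_zero)
open B9Cor36GCubeLocDefectCover (rowInd_le_indicator_QT)
open Node00 (SiteY BlkY IBondY FBondY CfgY GaugeY SiteParY toKT conjY gBondY levY gaugeY IsGaugeLawS)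
open Node00.OpsYNablaBridge (chartY)

variable {d ℓ : ℕ} {hd : 1 ≤ d + 1} {hL : Odd (ℓ + 1) ∧ 1 < ℓ + 1} {b₀ b₁ : ℝ}
variable {𝔸 : Type} [NormedRing 𝔸] [NormedAlgebra ℂ 𝔸] [CompleteSpace 𝔸]
variable {ι : Type} [Fintype ι]

/-! ## §1  The column split by a cut-off, in real coordinates -/

section Split

variable (i : KIdx d ℓ hd hL b₀ b₁) (b : Module.Basis ι ℝ 𝔸)

omit [CompleteSpace 𝔸] in
/-- `M_h·W = M_h·W·M_ζ + M_h·W·(1 − M_ζ)` — insert `1 = M_ζ + (1 − M_ζ)` on the right. [cite: Balaban1985BackgroundPropagators, (3.105) p.414 (the `ζ_□̃` ∕ `1 − ζ_□̃` split), bookkeeping] -/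
theorem mul_eq_mul_cut_add_mul_one_sub (h ζ : SiteY i → ℝ) (W : (FBondY i → 𝔸) →ₗ[ℂ] (FBondY i → 𝔸)) :
    cutMulY (𝔸 := 𝔸) (hBdY i h) * W =
      cutMulY (𝔸 := 𝔸) (hBdY i h) * W * cutMulY (𝔸 := 𝔸) (hBdY i ζ) +
        cutMulY (𝔸 := 𝔸) (hBdY i h) * W * (1 - cutMulY (𝔸 := 𝔸) (hBdY i ζ)) := by
  rw [← mul_add, add_sub_cancel, mul_one]

omit [CompleteSpace 𝔸] in
/-- ★ the split after `conj b(·^ℝ)`: `conj b((M_h·W)^ℝ) = conj b((M_h·W·M_ζ)^ℝ) + conj b((M_h·W·(1 − M_ζ))^ℝ)`.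
[cite: Balaban1985BackgroundPropagators, (3.105) p.414; Balaban1984PropagatorsII, p.232 («A summation preserves it also»)] -/
theorem conj_rowcut_split (h ζ : SiteY i → ℝ) (W : (FBondY i → 𝔸) →ₗ[ℂ] (FBondY i → 𝔸)) :
    conj b ((cutMulY (𝔸 := 𝔸) (hBdY i h) * W).restrictScalars ℝ) =
      conj b ((cutMulY (𝔸 := 𝔸) (hBdY i h) * W * cutMulY (𝔸 := 𝔸) (hBdY i ζ)).restrictScalars ℝ) +
        conj b ((cutMulY (𝔸 := 𝔸) (hBdY i h) * W * (1 - cutMulY (𝔸 := 𝔸) (hBdY i ζ))).restrictScalars ℝ) := by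
  have e : ((cutMulY (𝔸 := 𝔸) (hBdY i h) * W).restrictScalars ℝ : Module.End ℝ (FBondY i → 𝔸)) =
      (cutMulY (𝔸 := 𝔸) (hBdY i h) * W * cutMulY (𝔸 := 𝔸) (hBdY i ζ)).restrictScalars ℝ +
        (cutMulY (𝔸 := 𝔸) (hBdY i h) * W * (1 - cutMulY (𝔸 := 𝔸) (hBdY i ζ))).restrictScalars ℝ := by
    conv_lhs => rw [mul_eq_mul_cut_add_mul_one_sub i h ζ W]
    exact LinearMap.ext fun _ => rfl
  rw [e, B9Thm39CinvTorusRegular.conj_add]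

omit [CompleteSpace 𝔸] in
/-- ★ the far word in real coordinates: `conj b((M_h·W·(1 − M_ζ))^ℝ) = (mulOp h♭·conj b(W^ℝ))·mulOp(1 − ζ♭)`.
[cite: Balaban1985BackgroundPropagators, (3.105) p.414; Balaban1984PropagatorsII, (2.52)–(2.55) p.232] -/
theorem conj_rowcut_far_eq (h ζ : SiteY i → ℝ) (W : (FBondY i → 𝔸) →ₗ[ℂ] (FBondY i → 𝔸)) :
    conj b ((cutMulY (𝔸 := 𝔸) (hBdY i h) * W * (1 - cutMulY (𝔸 := 𝔸) (hBdY i ζ))).restrictScalars ℝ) =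
      (mulOp (fun p : FBondY i × ι => hBdY i h p.1) * conj b (W.restrictScalars ℝ)) * mulOp (fun p : FBondY i × ι => 1 - hBdY i ζ p.1) := by
  have e : ((cutMulY (𝔸 := 𝔸) (hBdY i h) * W * (1 - cutMulY (𝔸 := 𝔸) (hBdY i ζ))).restrictScalars ℝ : Module.End ℝ (FBondY i → 𝔸)) =
      (cutMulY (𝔸 := 𝔸) (hBdY i h)).restrictScalars ℝ * W.restrictScalars ℝ * ((1 - cutMulY (𝔸 := 𝔸) (hBdY i ζ)).restrictScalars ℝ) :=
    LinearMap.ext fun _ => rfl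
  rw [e, B9Eq352DivFormLetters.conj_mul, B9Eq352DivFormLetters.conj_mul, conj_cutMulY, conj_one_sub_cutMulY]

omit [CompleteSpace 𝔸] in
/-- the row-cut word in real coordinates: `conj b((M_h·W)^ℝ) = mulOp h♭·conj b(W^ℝ)`. [cite: Balaban1984PropagatorsII, (2.52) p.232, bookkeeping] -/
theorem conj_rowcut_eq (h : SiteY i → ℝ) (W : (FBondY i → 𝔸) →ₗ[ℂ] (FBondY i → 𝔸)) :
    conj b ((cutMulY (𝔸 := 𝔸) (hBdY i h) * W).restrictScalars ℝ) = mulOp (fun p : FBondY i × ι => hBdY i h p.1) * conj b (W.restrictScalars ℝ) := by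
  have e : ((cutMulY (𝔸 := 𝔸) (hBdY i h) * W).restrictScalars ℝ : Module.End ℝ (FBondY i → 𝔸)) =
      (cutMulY (𝔸 := 𝔸) (hBdY i h)).restrictScalars ℝ * W.restrictScalars ℝ := LinearMap.ext fun _ => rfl
  rw [e, B9Eq352DivFormLetters.conj_mul, conj_cutMulY]

end Split

/-! ## §2  Letter-free: a leading cut-off puts its row indicator on any majorant; rows and sources separated ⟹ the exponential splits -/

section Generic

variable {g : B9.Geometry} [Fintype g.Site] [DecidableEq g.Site] {Rg : ℝ} {Hg : Prop} {X : Type}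

/-- a LEADING cut-off `f` supported over `S` puts the row indicator `𝟙_S(a)` on any majorant of `mulOp f·T` (the product vanishes off `supp f`).
[cite: Balaban1984PropagatorsII, (2.51)–(2.52) p.232, (2.36) p.229, bookkeeping] -/
theorem hasMajorant_rowInd_of_mulOp (blk : X → g.Site) {T : Module.End ℝ (X → ℝ)} {K : g.Site → g.Site → ℝ} (f : X → ℝ)
    (h : HasMajorant (g := toB6 g Rg Hg) blk (mulOp f * T) K) (S : Finset g.Site) (hf0 : ∀ x, blk x ∉ S → f x = 0) :
    HasMajorant (g := toB6 g Rg Hg) blk (mulOp f * T) (fun (a b' : g.Site) => (if a ∈ S then (1 : ℝ) else 0) * K a b') := by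
  intro (y' : g.Site) μ B hμ x
  show |(mulOp f * T) μ x| ≤ ((if blk x ∈ S then (1 : ℝ) else 0) * K (blk x) y') * B
  by_cases hx : blk x ∈ S
  · rw [if_pos hx, one_mul]; exact h y' μ B hμ x
  · rw [Module.End.mul_apply, mulOp_apply, hf0 x hx, zero_mul, abs_zero, if_neg hx, zero_mul, zero_mul]

/-- `e^{−r_T·D} ≤ e^{−r_sep·D_sep}·e^{−r_ρ·D}` for `r_sep + r_ρ ≤ r_T`, `r_sep ≥ 0`, `0 ≤ D`, `D_sep ≤ D`. [cite: Balaban1984PropagatorsII, (2.83)–(2.85) pp.237–238, bookkeeping] -/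
theorem exp_sep_split {rT rsep rρ Dsep D : ℝ} (hrsep : 0 ≤ rsep) (hsplit : rsep + rρ ≤ rT) (hD : 0 ≤ D) (hsep : Dsep ≤ D) :
    Real.exp (-(rT * D)) ≤ Real.exp (-(rsep * Dsep)) * Real.exp (-(rρ * D)) := by
  rw [← Real.exp_add]
  refine Real.exp_le_exp.2 ?_
  have h1 : (rsep + rρ) * D ≤ rT * D := mul_le_mul_of_nonneg_right hsplit hD
  have h2 : rsep * Dsep ≤ rsep * D := mul_le_mul_of_nonneg_left hsep hrsep
  nlinarith

/-- ★ **ROWS AND SOURCES SEPARATED ⟹ THE EXPONENTIAL SPLITS.**  `T ≺ 𝟙_S(a)·κ·w(a)·e^{−r_T·d(a,b′)}` (`κ ≥ 0`, `w ≥ 0`), a trailing cut-off `|m| ≤ 1` supported over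
`Z`, `d(a, y) ≥ D_sep` for `a ∈ S`, `y ∈ Z`, and `r_sep + r_ρ ≤ r_T` (`r_sep ≥ 0`) give `T·mulOp m ≺ 𝟙_S(a)·(κ·e^{−r_sep·D_sep})·w(a)·e^{−r_ρ·d(a,b′)}` — the source is
localized in `Z` by `m` (`hasMajorant_mul_mulOp_right`), and on `S × Z` the kernel's exponential pays the separation.  No intermediate variable, no (2.61); rates absolute
(consumers put `r = a·δ₀`).
[cite: Balaban1985BackgroundPropagators, (3.105) p.414 («supp h_□ is separated from supp (1 − ζ_□̃) by a distance ≧ M»), p.415 l.21–24, p.412 l.31–36; Balaban1984PropagatorsII, (2.83)–(2.85) pp.237–238, (2.52) p.232] -/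
theorem rowSep_majorant_blk (blk : X → g.Site) {rT rsep rρ κ Dsep : ℝ} (w : g.Site → ℝ) (S Z : Finset g.Site) (m : X → ℝ)
    (hκ : 0 ≤ κ) (hw : ∀ y, 0 ≤ w y) (hrsep : 0 ≤ rsep) (hsplit : rsep + rρ ≤ rT)
    (hdnn : ∀ a y : g.Site, 0 ≤ g.dist a y)
    (hm1 : ∀ x, |m x| ≤ 1) (hm0 : ∀ x, m x ≠ 0 → blk x ∈ Z) (hsep : ∀ a ∈ S, ∀ y ∈ Z, Dsep ≤ g.dist a y)
    {T : Module.End ℝ (X → ℝ)}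
    (hT : HasMajorant (g := toB6 g Rg Hg) blk T
      (fun (a b' : g.Site) => (if a ∈ S then (1 : ℝ) else 0) * (κ * w a * Real.exp (-(rT * g.dist a b'))))) :
    HasMajorant (g := toB6 g Rg Hg) blk (T * mulOp m)
      (fun (a b' : g.Site) => (if a ∈ S then (1 : ℝ) else 0) * ((κ * Real.exp (-(rsep * Dsep))) * w a * Real.exp (-(rρ * g.dist a b')))) := by
  have hZ := hasMajorant_mul_mulOp_right (R := Rg) (H := Hg) blk hT m hm1 Z hm0
  refine hasMajorant_mono (g := toB6 g Rg Hg) _ hZ fun (a b' : g.Site) => ?_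
  have hrhs : 0 ≤ (if a ∈ S then (1 : ℝ) else 0) * ((κ * Real.exp (-(rsep * Dsep))) * w a * Real.exp (-(rρ * g.dist a b'))) :=
    mul_nonneg (by split_ifs <;> norm_num) (mul_nonneg (mul_nonneg (mul_nonneg hκ (Real.exp_nonneg _)) (hw a)) (Real.exp_nonneg _))
  by_cases hb' : b' ∈ Z
  · by_cases ha : a ∈ S
    · simp only [hb', ha, if_true, one_mul]
      have hE := exp_sep_split hrsep hsplit (hdnn a b') (hsep a ha b' hb')
      calc κ * w a * Real.exp (-(rT * g.dist a b'))
          ≤ κ * w a * (Real.exp (-(rsep * Dsep)) * Real.exp (-(rρ * g.dist a b'))) :=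
            mul_le_mul_of_nonneg_left hE (mul_nonneg hκ (hw a))
        _ = κ * Real.exp (-(rsep * Dsep)) * w a * Real.exp (-(rρ * g.dist a b')) := by ring
    · simp only [ha, if_false, zero_mul, mul_zero]; exact le_rfl
  · simp only [hb', if_false, zero_mul]; exact hrhs

end Generic


/-! ## §3  At def-Y's letters, per cube, at the ζ of record: the far columns of `M_{h_□}·P` and of `M_{h_□}·Pl_□` -/

section Far

variable (i : KIdx d ℓ hd hL b₀ b₁) (c : ↥(cubes (toKT i).D.toDomains)) (b : Module.Basis ι ℝ 𝔸)

/-- ★ **UNDER THE ROW INDICATOR THE CUBE BLOCK's (3.41) LENGTH IS THE MEMBER BLOCK's**: if the cube block of `x₋` meets `supp h_□`, then `ℓ_□(Δ_□(x₋)) = ℓ(Δ(x₋))`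
(two sites of one cube block share their member block — r05∕r03 `blkOf_eq_of_cube_blkOf_eq` —, and near □ the cube level is the member's — `levCubeY_eq_levY_of_nearH`).
[cite: Balaban1985BackgroundPropagators, p.408 (□̃³ ⊂ Ω_j(□)), (3.89) p.409, (3.41) p.397; Balaban1984PropagatorsII, (2.45) p.231, (2.1)–(2.2) p.224] -/
theorem len_cube_eq_len_member_of_rowInd (ιB : BlkY i → IBondY i) (hι : ∀ s, β i.hN i.D i.hk (ιB s) = s) {x : FBondY i}
    (hx : ∃ z : SiteY i, blkCubeY i c z = blkCubeY i c (chartY i x.src) ∧ hTY i c z ≠ 0) :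
    (geoCK i c).len (blkCubeY i c (chartY i x.src)) = (geo9K i).len (ιB (blkOf i.D.toDomains (chartY i x.src))) := by
  obtain ⟨z, hz, hT⟩ := hx
  have hnear := nearH_of_hTY_ne_zero i c hT
  have hblk : blkOf i.D.toDomains z = blkOf i.D.toDomains (chartY i x.src) := by
    have hz' := hz
    rw [blkCubeY_apply, blkCubeY_apply] at hz'
    unfold B9CubeLettersOpsL0.cubeFamY at hz'
    exact B9CubeCoarsening.blkOf_eq_of_cube_blkOf_eq hz'
  rw [← hz, (geoCK_len_blkCubeY i c z).1, levCubeY_eq_levY_of_nearH i c hnear, ← hblk, geo9K_len_site i ιB hι z]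

omit [CompleteSpace 𝔸] in
open Classical in
set_option maxHeartbeats 1600000 in
/-- ★★ **THE FAR COLUMNS OF `M_{h_□}·P`**: for a member bond operator `P` with `conj b(P^ℝ) ≺ K_P·ℓ(a)⁻²·e^{−a_Pδ₀d}` ((3.49)₄ shape, Z2-P's output for `P = DPD*(U₁)`), a
row profile `h` with `|h♭| ≤ 1` whose rows lie in `S_□`-blocks, and `a_sep + ρ ≤ a_P`:
`conj b((M_h·P·(1 − M_{ζ_□̃}))^ℝ) ≺ 𝟙[a ∈ S_□]·(K_P·e^{−a_sep·δ₀·D_sep})·ℓ(a)⁻²·e^{−ρδ₀d(a,b′)}` — the sources of `1 − ζ_□̃` lie outside `S^χ_□` (`not_mem_SQbigT_bond`),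
at distance `≥ D_sep` from `S_□` (p21 `hsep_cover`).
[cite: Balaban1985BackgroundPropagators, (3.105)–(3.106) p.414, p.414 («supp h_□ is separated from supp (1 − ζ_□̃) by a distance ≧ M»), p.415 l.21–24, (3.49) p.399, p.412 l.31–36; Balaban1984PropagatorsII, (2.83)–(2.85) pp.237–238, (2.51)–(2.52) p.232] -/
theorem hasMajorant_far_P (h : SiteY i → ℝ) (hh1 : ∀ f : FBondY i, |hBdY i h f| ≤ 1)
    [Fintype (geo9K i).Site] (ιB : BlkY i → IBondY i) (hι : ∀ s, β i.hN i.D i.hk (ιB s) = s) (Rr : ℝ) (Hp : Prop)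
    (hhS : ∀ f : FBondY i, hBdY i h f ≠ 0 → ιB (blkV1 i.hN i.D f) ∈ SQT i c)
    (P : (FBondY i → 𝔸) →ₗ[ℂ] (FBondY i → 𝔸)) {δ₀ aP asep ρ KP : ℝ}
    (hδ₀ : 0 ≤ δ₀) (hKP : 0 ≤ KP) (hasep : 0 ≤ asep) (hsplit : asep + ρ ≤ aP)
    (hP : HasMajorant (g := toB6 (geo9K i) Rr Hp) (fun p : FBondY i × ι => ιB (blkV1 i.hN i.D p.1)) (conj b (P.restrictScalars ℝ))
      (fun a y => KP * ((geo9K i).len a ^ 2)⁻¹ * Real.exp (-(aP * δ₀ * (geo9K i).dist a y)))) :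
    HasMajorant (g := toB6 (geo9K i) Rr Hp) (fun p : FBondY i × ι => ιB (blkV1 i.hN i.D p.1))
      (conj b ((cutMulY (𝔸 := 𝔸) (hBdY i h) * P * (1 - cutMulY (𝔸 := 𝔸) (hBdY i (zetaY i c)))).restrictScalars ℝ))
      (fun a b' => (if a ∈ SQT i c then (1 : ℝ) else 0) *
        ((KP * Real.exp (-(asep * δ₀ * DsepT i))) * ((geo9K i).len a ^ 2)⁻¹ * Real.exp (-(ρ * δ₀ * (geo9K i).dist a b')))) := by
  obtain ⟨-, hsymm, hdnn⟩ := geo9K_axioms i Rr Hp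
  set blk : FBondY i × ι → (geo9K i).Site := fun p => ιB (blkV1 i.hN i.D p.1) with hblk
  -- rows: the leading cut-off keeps the majorant and puts the row indicator on it
  have h1 : HasMajorant (g := toB6 (geo9K i) Rr Hp) blk (mulOp (fun p : FBondY i × ι => hBdY i h p.1) * conj b (P.restrictScalars ℝ))
      (fun a y => KP * ((geo9K i).len a ^ 2)⁻¹ * Real.exp (-(aP * δ₀ * (geo9K i).dist a y))) :=
    B9Eq395Small.hasMajorant_mulOp_left (G := toB6 (geo9K i) Rr Hp) blk hP _ fun p => hh1 p.1
  have h2 := hasMajorant_rowInd_of_mulOp (Rg := Rr) (Hg := Hp) blk _ h1 (SQT i c) fun p hp => by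
    by_contra hne; exact hp (hhS p.1 hne)
  -- sources: the rows of `1 − ζ_□̃♭` lie outside `S^χ_□`, `D_sep` away from `S_□`
  set Z : Finset (geo9K i).Site := Finset.univ.filter fun y => y ∉ SQbigT i c with hZ
  have hm0 : ∀ p : FBondY i × ι, (1 - hBdY i (zetaY i c) p.1) ≠ 0 → blk p ∈ Z := fun p hp => by
    have hne : hBdY i (zetaY i c) p.1 ≠ 1 := fun h1 => hp (by rw [h1, sub_self])
    exact Finset.mem_filter.2 ⟨Finset.mem_univ _, not_mem_SQbigT_bond i c ιB hι hne⟩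
  have hsep : ∀ a ∈ SQT i c, ∀ y ∈ Z, DsepT i ≤ (geo9K i).dist a y := fun a ha y hy => by
    rw [hsymm]; exact hsep_cover i c y (Finset.mem_filter.1 hy).2 a ha
  have hsplit' : asep * δ₀ + ρ * δ₀ ≤ aP * δ₀ := by nlinarith
  have h3 := rowSep_majorant_blk (Rg := Rr) (Hg := Hp) blk (fun a => ((geo9K i).len a ^ 2)⁻¹) (SQT i c) Z
    (fun p : FBondY i × ι => 1 - hBdY i (zetaY i c) p.1) hKP (fun a => inv_nonneg.2 (sq_nonneg _)) (mul_nonneg hasep hδ₀) hsplit' hdnn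
    (fun p => abs_one_sub_hBdY_zetaY_le_one i c p.1) hm0 hsep h2
  rw [conj_rowcut_far_eq]
  exact h3

omit [CompleteSpace 𝔸] in
open Classical in
set_option maxHeartbeats 1600000 in
/-- ★★ **THE MEMBER-SIDE MAJORANT OF `M_{h_□}·R(γ)⁻¹·M·R(γ)` FROM A CUBE-SIDE `(3.49)₄`-SHAPE DATUM**: `conj b(M) ≺ K_C·ℓ_□(a)⁻²·e^{−δd_□}` over the cube sequence's blocks
`(toB6 (geoCK i □) Rr H, blkBK i □)`, `γ` bi-contractive, (2.61) on the cube geometry at the splitting exponent `α ≤ 1` ⟹ over the member's blocks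
`conj b((M_{h_□}·R(γ)⁻¹·M·R(γ))^ℝ) ≺ (M₂Σ‖b_j‖)²·𝟙^row_□(a)·(K_C·c₁(δ,α))·ℓ(a)⁻²·e^{−(1−α)δd(a,a′)}` — p38's source-global transfer α-T with the row indicator as `G₁` and the
weight `ℓ_□⁻²`, honest because under the indicator `ℓ_□(Δ_□x) = ℓ(Δx)` (`len_cube_eq_len_member_of_rowInd`).  NO source cut-off.
[cite: Balaban1985BackgroundPropagators, Cor. 3.6 p.408 l.11–14, p.409 l.1–5, (3.49) p.399, (3.105)–(3.106) p.414; Balaban1984PropagatorsII, (2.51)–(2.52) p.232, (2.46) p.231, Lemma 2.1 (2.61) p.234] -/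
theorem hasMajorant_conj_hTY_sandwich_of_cube {M₂ : ℝ} (hM₂ : 0 ≤ M₂) (hrepr : ∀ (v : 𝔸) (j : ι), |b.repr v j| ≤ M₂ * ‖v‖)
    (γ : FBondY i → 𝔸ˣ) (hγ : ∀ f a, ‖R (γ f) a‖ ≤ ‖a‖ ∧ ‖R (γ f)⁻¹ a‖ ≤ ‖a‖)
    (ιB : BlkY i → IBondY i) (hι : ∀ s, β i.hN i.D i.hk (ιB s) = s) (Rr : ℝ) (H : Prop) [Fintype (geo9K i).Site] (Rr' : ℝ) (Hp : Prop)
    (dB : ℕ) {KC δ α : ℝ} (hKC : 0 ≤ KC) (hδ : 0 ≤ δ) (hα1 : α ≤ 1) (h261 : Ineq261 dB (toB6 (geoCK i c) Rr H) δ α)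
    (M : Module.End ℝ (FBondY i → 𝔸))
    (hM : HasMajorant (g := toB6 (geoCK i c) Rr H) (blkBK i c) (conj b M)
      (fun a s => KC * ((geoCK i c).len a ^ 2)⁻¹ * Real.exp (-(δ * (geoCK i c).dist a s)))) :
    HasMajorant (g := toB6 (geo9K i) Rr' Hp) (fun p : FBondY i × ι => ιB (blkV1 i.hN i.D p.1))
      (conj b ((cutMulY (𝔸 := 𝔸) (hBdY i (hTY i c))).restrictScalars ℝ ∘ₗ (conjY γ⁻¹).restrictScalars ℝ ∘ₗ M ∘ₗ (conjY γ).restrictScalars ℝ))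
      (fun a a' => (M₂ * ∑ j, ‖b j‖) ^ 2 *
        ((if ∃ x : FBondY i, ιB (blkOf i.D.toDomains (chartY i x.src)) = a ∧
              ∃ z : SiteY i, blkCubeY i c z = blkCubeY i c (chartY i x.src) ∧ hTY i c z ≠ 0 then KC * B6.c1 dB δ α else 0) *
          ((geo9K i).len a ^ 2)⁻¹ * Real.exp (-((1 - α) * δ * (geo9K i).dist a a')))) := by
  have hκ : 0 ≤ KC * B6.c1 dB δ α := mul_nonneg hKC (c1_nonneg _ _ _)
  refine hasMajorant_conj_bond_sandwich_src_global i c b hM₂ hrepr γ hγ (hBdY i (hTY i c))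
    (fun a => if ∃ z : SiteY i, blkCubeY i c z = a ∧ hTY i c z ≠ 0 then (1 : ℝ) else 0) (abs_hBdY_hTY_le_indicator i c)
    ιB hι Rr H Rr' Hp dB hKC hδ hα1 (fun s => ((geoCK i c).len s ^ 2)⁻¹) (fun s => inv_nonneg.2 (sq_nonneg _)) h261 (fun x a' => ?_) M hM
  by_cases hx : ∃ z : SiteY i, blkCubeY i c z = blkCubeY i c (chartY i x.src) ∧ hTY i c z ≠ 0
  · rw [if_pos hx, if_pos ⟨x, rfl, hx⟩, one_mul, len_cube_eq_len_member_of_rowInd i c ιB hι hx]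
    exact le_of_eq (by ring)
  · rw [if_neg hx, zero_mul, zero_mul, zero_mul]
    exact mul_nonneg (mul_nonneg (by split_ifs <;> [exact hκ; exact le_rfl]) (inv_nonneg.2 (sq_nonneg _))) (Real.exp_nonneg _)

/-- `M_h·Pl_□ = M_h ∘ R(γ)⁻¹ ∘ DP_□D*(Ṽ) ∘ R(γ)` (realified), `γ = u` read on bonds — G-F2's `locProjBY` IS a sandwich.
[cite: Balaban1985BackgroundPropagators, (3.105) p.414, (3.34) p.396, bookkeeping] -/
theorem cutMulY_mul_locProjBY_eq (parS : SiteParY 𝔸 i) (g : GaugeY 𝔸 i) (h : SiteY i → ℝ) (V : CfgY 𝔸 i) :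
    ((cutMulY (𝔸 := 𝔸) (hBdY i h) * locProjBY i c parS g V).restrictScalars ℝ : Module.End ℝ (FBondY i → 𝔸)) =
      (cutMulY (𝔸 := 𝔸) (hBdY i h)).restrictScalars ℝ ∘ₗ (conjY (gBondY i g)⁻¹).restrictScalars ℝ ∘ₗ
        (DPDsCubeY i c parS V).restrictScalars ℝ ∘ₗ (conjY (gBondY i g)).restrictScalars ℝ := by
  rw [locProjBY]
  exact LinearMap.ext fun _ => rfl

open Classical in
set_option maxHeartbeats 1600000 in
/-- ★★ **THE FAR COLUMNS OF `M_{h_□}·Pl_□`**: from the cube-side (3.49)₄ datum `conj b((DP_□D*(Ṽ))^ℝ) ≺ K_C·ℓ_□(a)⁻²·e^{−δ_Pd_□}` (D2a's shape), a bi-contractive gauge `u`,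
(2.61) on the cube geometry at `α ≤ 1`, and the budget `a_sep·δ₀ + ρ·δ₀ ≤ (1−α)·δ_P`:
`conj b((M_{h_□}·Pl_□·(1 − M_{ζ_□̃}))^ℝ) ≺ 𝟙[a ∈ S_□]·((M₂Σ‖b_j‖)²·K_Cc₁(δ_P,α)·e^{−a_sep·δ₀·D_sep})·ℓ(a)⁻²·e^{−ρδ₀d(a,b′)}`.
[cite: Balaban1985BackgroundPropagators, (3.105)–(3.106) p.414 («separated … by a distance ≧ M»), p.415 l.21–24, (3.49) p.399, Cor. 3.6 p.408, p.409 l.1–5, p.412 l.31–36; Balaban1984PropagatorsII, (2.83)–(2.85) pp.237–238, (2.51)–(2.52) p.232, Lemma 2.1 (2.61) p.234] -/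
theorem hasMajorant_far_locProjBY {M₂ : ℝ} (hM₂ : 0 ≤ M₂) (hrepr : ∀ (v : 𝔸) (j : ι), |b.repr v j| ≤ M₂ * ‖v‖)
    (parS : SiteParY 𝔸 i) (u : GaugeY 𝔸 i) (hu : ∀ x, ‖((u x : 𝔸ˣ) : 𝔸)‖ ≤ 1 ∧ ‖(((u x)⁻¹ : 𝔸ˣ) : 𝔸)‖ ≤ 1) (V : CfgY 𝔸 i)
    (ιB : BlkY i → IBondY i) (hι : ∀ s, β i.hN i.D i.hk (ιB s) = s) (Rr : ℝ) (H : Prop) [Fintype (geo9K i).Site] (Rr' : ℝ) (Hp : Prop)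
    (dB : ℕ) {KC δP α δ₀ asep ρ : ℝ} (hKC : 0 ≤ KC) (hδP : 0 ≤ δP) (hα1 : α ≤ 1) (h261 : Ineq261 dB (toB6 (geoCK i c) Rr H) δP α)
    (hδ₀ : 0 ≤ δ₀) (hasep : 0 ≤ asep) (hsplit : asep * δ₀ + ρ * δ₀ ≤ (1 - α) * δP)
    (hPlC : HasMajorant (g := toB6 (geoCK i c) Rr H) (blkBK i c) (conj b ((DPDsCubeY i c parS V).restrictScalars ℝ))
      (fun a s => KC * ((geoCK i c).len a ^ 2)⁻¹ * Real.exp (-(δP * (geoCK i c).dist a s)))) :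
    HasMajorant (g := toB6 (geo9K i) Rr' Hp) (fun p : FBondY i × ι => ιB (blkV1 i.hN i.D p.1))
      (conj b ((cutMulY (𝔸 := 𝔸) (hBdY i (hTY i c)) * locProjBY i c parS u V * (1 - cutMulY (𝔸 := 𝔸) (hBdY i (zetaY i c)))).restrictScalars ℝ))
      (fun a b' => (if a ∈ SQT i c then (1 : ℝ) else 0) *
        (((M₂ * ∑ j, ‖b j‖) ^ 2 * (KC * B6.c1 dB δP α) * Real.exp (-(asep * δ₀ * DsepT i))) * ((geo9K i).len a ^ 2)⁻¹ *
          Real.exp (-(ρ * δ₀ * (geo9K i).dist a b')))) := by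
  obtain ⟨-, hsymm, hdnn⟩ := geo9K_axioms i Rr' Hp
  set blk : FBondY i × ι → (geo9K i).Site := fun p => ιB (blkV1 i.hN i.D p.1) with hblk
  have hγ : ∀ (f : FBondY i) (a : 𝔸), ‖R (gBondY i u f) a‖ ≤ ‖a‖ ∧ ‖R (gBondY i u f)⁻¹ a‖ ≤ ‖a‖ := fun f a =>
    ⟨norm_R_le (hu _).1 (hu _).2 a, norm_R_inv_le (hu _).1 (hu _).2 a⟩
  have hκ : 0 ≤ KC * B6.c1 dB δP α := mul_nonneg hKC (c1_nonneg _ _ _)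
  have hSb : 0 ≤ (M₂ * ∑ j, ‖b j‖) ^ 2 := sq_nonneg _
  -- the row-cut sandwich on the member's blocks, then the row indicator read as `𝟙[a ∈ S_□]`
  have h1 := hasMajorant_conj_hTY_sandwich_of_cube i c b hM₂ hrepr (gBondY i u) hγ ιB hι Rr H Rr' Hp dB hKC hδP hα1 h261 _ hPlC
  have h2 : HasMajorant (g := toB6 (geo9K i) Rr' Hp) blk
      (conj b ((cutMulY (𝔸 := 𝔸) (hBdY i (hTY i c)) * locProjBY i c parS u V).restrictScalars ℝ))
      (fun a b' => (if a ∈ SQT i c then (1 : ℝ) else 0) *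
        (((M₂ * ∑ j, ‖b j‖) ^ 2 * (KC * B6.c1 dB δP α)) * ((geo9K i).len a ^ 2)⁻¹ * Real.exp (-((1 - α) * δP * (geo9K i).dist a b')))) := by
    rw [cutMulY_mul_locProjBY_eq]
    refine hasMajorant_mono (g := toB6 (geo9K i) Rr' Hp) _ h1 fun a b' => ?_
    have hind := rowInd_le_indicator_QT i c ιB hι a
    by_cases ha : a ∈ SQT i c
    · simp only [ha, if_true, one_mul]
      have hle : (if ∃ x : FBondY i, ιB (blkOf i.D.toDomains (chartY i x.src)) = a ∧
            ∃ z : SiteY i, blkCubeY i c z = blkCubeY i c (chartY i x.src) ∧ hTY i c z ≠ 0 then KC * B6.c1 dB δP α else 0) ≤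
          KC * B6.c1 dB δP α := by
        split_ifs <;> [exact le_rfl; exact hκ]
      calc _ ≤ (M₂ * ∑ j, ‖b j‖) ^ 2 * ((KC * B6.c1 dB δP α) * ((geo9K i).len a ^ 2)⁻¹ * Real.exp (-((1 - α) * δP * (geo9K i).dist a b'))) :=
            mul_le_mul_of_nonneg_left (mul_le_mul_of_nonneg_right (mul_le_mul_of_nonneg_right hle (inv_nonneg.2 (sq_nonneg _)))
              (Real.exp_nonneg _)) hSb
        _ = _ := by ring
    · have hQ : β i.hN i.D i.hk a ∉ B6Partition118KLevelTorusCentral.QT i.D (B9GeoLemma21KLevelV1.one_le_Mh i)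
          (B9Thm37CubeCoverCommutatorSizes.four_le_P' i) c := fun hm => ha ((mem_SQT i c a).2 hm)
      rw [if_neg hQ] at hind
      have h0 : (if ∃ x : FBondY i, ιB (blkOf i.D.toDomains (chartY i x.src)) = a ∧
            ∃ z : SiteY i, blkCubeY i c z = blkCubeY i c (chartY i x.src) ∧ hTY i c z ≠ 0 then KC * B6.c1 dB δP α else 0) = 0 := by
        split_ifs with hx
        · rw [if_pos hx] at hind; exact absurd hind (by norm_num)
        · rfl
      rw [h0, zero_mul, zero_mul, mul_zero]
      simp only [ha, if_false, zero_mul]; exact le_rfl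
  -- sources outside `S^χ_□`, separation `D_sep`
  set Z : Finset (geo9K i).Site := Finset.univ.filter fun y => y ∉ SQbigT i c with hZ
  have hm0 : ∀ p : FBondY i × ι, (1 - hBdY i (zetaY i c) p.1) ≠ 0 → blk p ∈ Z := fun p hp => by
    have hne : hBdY i (zetaY i c) p.1 ≠ 1 := fun h1 => hp (by rw [h1, sub_self])
    exact Finset.mem_filter.2 ⟨Finset.mem_univ _, not_mem_SQbigT_bond i c ιB hι hne⟩
  have hsep : ∀ a ∈ SQT i c, ∀ y ∈ Z, DsepT i ≤ (geo9K i).dist a y := fun a ha y hy => by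
    rw [hsymm]; exact hsep_cover i c y (Finset.mem_filter.1 hy).2 a ha
  have h3 := rowSep_majorant_blk (Rg := Rr') (Hg := Hp) blk (fun a => ((geo9K i).len a ^ 2)⁻¹) (SQT i c) Z
    (fun p : FBondY i × ι => 1 - hBdY i (zetaY i c) p.1) (mul_nonneg hSb hκ) (fun a => inv_nonneg.2 (sq_nonneg _)) (mul_nonneg hasep hδ₀) hsplit hdnn
    (fun p => abs_one_sub_hBdY_zetaY_le_one i c p.1) hm0 hsep h2
  rw [conj_rowcut_far_eq, ← conj_rowcut_eq]
  exact h3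

end Far

/-! ## §4  The located difference with GLOBAL sources, from the near binder and the far pieces -/

section Located

variable (i : KIdx d ℓ hd hL b₀ b₁) (c : ↥(cubes (toKT i).D.toDomains)) (b : Module.Basis ι ℝ 𝔸)

omit [CompleteSpace 𝔸] in
/-- `e^{−a·δ₀·D} ≤ e^{−ρ·δ₀·D}` for `ρ ≤ a`, `δ₀, D ≥ 0`. [cite: Balaban1984PropagatorsII, (2.61) p.234, bookkeeping] -/
theorem exp_rate_mono {a ρ δ₀ D : ℝ} (hρa : ρ ≤ a) (hδ₀ : 0 ≤ δ₀) (hD : 0 ≤ D) : Real.exp (-(a * δ₀ * D)) ≤ Real.exp (-(ρ * δ₀ * D)) :=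
  Real.exp_le_exp.2 (by nlinarith [mul_le_mul_of_nonneg_right hρa (mul_nonneg hδ₀ hD)])

open Classical in
set_option maxHeartbeats 3200000 in
/-- ★★★ **THE LOCATED DIFFERENCE OF THE TRANSPOSED FAMILY 3, WITH GLOBAL SOURCES.**  Per cube `□`, for the member word `P` (any bond operator with the (3.49)₄-shape member
majorant `hP`) and the transported cube projection `Pl_□ = locProjBY □ parS u Ṽ` (cube-side datum `hPlC` of `DP_□D*(Ṽ)`): from the NEAR binder
`hXn : conj b((M_{h_□}·(P − Pl_□)·M_{ζ_□̃})^ℝ) ≺ K_n·ℓ(a)⁻²·e^{−a_nδ₀d}` (the both-sides-located word at the swapped pair — F3-B's per-cube theorem at `(ζ, h) := (hTY i □, zetaY i □)`),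
`hP`, `hPlC`, a bi-contractive `u`, (2.61) on the cube geometry at `α ≤ 1`, and the budgets `ρ ≤ a_n`, `a_sep + ρ ≤ a_P`, `a_sep·δ₀ + ρ·δ₀ ≤ (1−α)·δ_P`:
`conj b((M_{h_□}·(P − Pl_□))^ℝ) ≺ K_T·ℓ(a)⁻²·e^{−ρδ₀d(a,b′)}`, `K_T = K_n + (K_P + (M₂Σ‖b_j‖)²·K_Cc₁(δ_P,α))·e^{−a_sep·δ₀·D_sep}` — F3-C's `hX` currency, sources GLOBAL.
[cite: Balaban1985BackgroundPropagators, (3.105)–(3.106) p.414, p.415 l.18–37, p.412 l.22–36, (3.49) p.399, (3.25) p.394, Cor. 3.6 p.408, p.409 l.1–5; Balaban1984PropagatorsII, (2.83)–(2.85) pp.237–238, (2.51)–(2.55) p.232, Lemma 2.1 (2.61) p.234] -/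
theorem hasMajorant_famThreeT_located {M₂ : ℝ} (hM₂ : 0 ≤ M₂) (hrepr : ∀ (v : 𝔸) (j : ι), |b.repr v j| ≤ M₂ * ‖v‖)
    (parS : SiteParY 𝔸 i) (u : GaugeY 𝔸 i) (hu : ∀ x, ‖((u x : 𝔸ˣ) : 𝔸)‖ ≤ 1 ∧ ‖(((u x)⁻¹ : 𝔸ˣ) : 𝔸)‖ ≤ 1) (V : CfgY 𝔸 i)
    (ιB : BlkY i → IBondY i) (hι : ∀ s, β i.hN i.D i.hk (ιB s) = s) (Rr : ℝ) (H : Prop) [Fintype (geo9K i).Site] (Rr' : ℝ) (Hp : Prop)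
    (P : (FBondY i → 𝔸) →ₗ[ℂ] (FBondY i → 𝔸)) (dB : ℕ) {δ₀ an aP asep ρ Kn KP KC δP α : ℝ}
    (hδ₀ : 0 ≤ δ₀) (hKn : 0 ≤ Kn) (hKP : 0 ≤ KP) (hKC : 0 ≤ KC) (hδP : 0 ≤ δP) (hα1 : α ≤ 1) (hasep : 0 ≤ asep)
    (hρn : ρ ≤ an) (hsplitP : asep + ρ ≤ aP) (hsplitC : asep * δ₀ + ρ * δ₀ ≤ (1 - α) * δP)
    (h261C : Ineq261 dB (toB6 (geoCK i c) Rr H) δP α)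
    (hXn : HasMajorant (g := toB6 (geo9K i) Rr' Hp) (fun p : FBondY i × ι => ιB (blkV1 i.hN i.D p.1))
      (conj b ((cutMulY (𝔸 := 𝔸) (hBdY i (hTY i c)) * (P - locProjBY i c parS u V) * cutMulY (𝔸 := 𝔸) (hBdY i (zetaY i c))).restrictScalars ℝ))
      (fun a y => Kn * ((geo9K i).len a ^ 2)⁻¹ * Real.exp (-(an * δ₀ * (geo9K i).dist a y))))
    (hP : HasMajorant (g := toB6 (geo9K i) Rr' Hp) (fun p : FBondY i × ι => ιB (blkV1 i.hN i.D p.1)) (conj b (P.restrictScalars ℝ))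
      (fun a y => KP * ((geo9K i).len a ^ 2)⁻¹ * Real.exp (-(aP * δ₀ * (geo9K i).dist a y))))
    (hPlC : HasMajorant (g := toB6 (geoCK i c) Rr H) (blkBK i c) (conj b ((DPDsCubeY i c parS V).restrictScalars ℝ))
      (fun a s => KC * ((geoCK i c).len a ^ 2)⁻¹ * Real.exp (-(δP * (geoCK i c).dist a s)))) :
    HasMajorant (g := toB6 (geo9K i) Rr' Hp) (fun p : FBondY i × ι => ιB (blkV1 i.hN i.D p.1))
      (conj b ((cutMulY (𝔸 := 𝔸) (hBdY i (hTY i c)) * (P - locProjBY i c parS u V)).restrictScalars ℝ))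
      (fun a y => (Kn + (KP + (M₂ * ∑ j, ‖b j‖) ^ 2 * (KC * B6.c1 dB δP α)) * Real.exp (-(asep * δ₀ * DsepT i))) *
        ((geo9K i).len a ^ 2)⁻¹ * Real.exp (-(ρ * δ₀ * (geo9K i).dist a y))) := by
  obtain ⟨-, -, hdnn⟩ := geo9K_axioms i Rr' Hp
  set blk : FBondY i × ι → (geo9K i).Site := fun p => ιB (blkV1 i.hN i.D p.1) with hblk
  have hh1 : ∀ f : FBondY i, |hBdY i (hTY i c) f| ≤ 1 := B9Cor36GCubeLocDefectTransfer.abs_hBdY_hTY_le_one i c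
  -- the two far pieces
  have hFP := hasMajorant_far_P i c b (hTY i c) hh1 ιB hι Rr' Hp (fun f hf => mem_SQT_of_hBdY_hTY_ne_zero i c ιB hι hf) P
    hδ₀ hKP hasep hsplitP hP
  have hFPl := hasMajorant_far_locProjBY i c b hM₂ hrepr parS u hu V ιB hι Rr H Rr' Hp dB hKC hδP hα1 h261C hδ₀ hasep hsplitC hPlC
  -- the far piece of the difference
  have efar : conj b ((cutMulY (𝔸 := 𝔸) (hBdY i (hTY i c)) * (P - locProjBY i c parS u V) *
        (1 - cutMulY (𝔸 := 𝔸) (hBdY i (zetaY i c)))).restrictScalars ℝ) =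
      conj b ((cutMulY (𝔸 := 𝔸) (hBdY i (hTY i c)) * P * (1 - cutMulY (𝔸 := 𝔸) (hBdY i (zetaY i c)))).restrictScalars ℝ) -
        conj b ((cutMulY (𝔸 := 𝔸) (hBdY i (hTY i c)) * locProjBY i c parS u V * (1 - cutMulY (𝔸 := 𝔸) (hBdY i (zetaY i c)))).restrictScalars ℝ) := by
    rw [← B9Eq352DivFormLetters.conj_sub]
    congr 1
    rw [mul_sub (cutMulY (𝔸 := 𝔸) (hBdY i (hTY i c))) P (locProjBY i c parS u V), sub_mul]
    exact LinearMap.ext fun _ => rfl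
  have hFar := B9Ineq368PPrime.hasMajorant_sub (R := Rr') (H := Hp) blk hFP hFPl
  rw [← efar] at hFar
  -- near + far
  have hsum := hasMajorant_add (g := toB6 (geo9K i) Rr' Hp) blk hXn hFar
  rw [← conj_rowcut_split] at hsum
  refine hasMajorant_mono (g := toB6 (geo9K i) Rr' Hp) _ hsum fun a y => ?_
  have hd := hdnn a y
  have hℓ : 0 ≤ ((geo9K i).len a ^ 2)⁻¹ := inv_nonneg.2 (sq_nonneg _)
  have hE : 0 ≤ Real.exp (-(ρ * δ₀ * (geo9K i).dist a y)) := Real.exp_nonneg _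
  have hS : 0 ≤ Real.exp (-(asep * δ₀ * DsepT i)) := Real.exp_nonneg _
  have hSb : 0 ≤ (M₂ * ∑ j, ‖b j‖) ^ 2 := sq_nonneg _
  have hκC : 0 ≤ KC * B6.c1 dB δP α := mul_nonneg hKC (c1_nonneg _ _ _)
  have hind : (if a ∈ SQT i c then (1 : ℝ) else 0) ≤ 1 := by split_ifs <;> norm_num
  have hind0 : 0 ≤ (if a ∈ SQT i c then (1 : ℝ) else 0) := by split_ifs <;> norm_num
  -- near term: rate `a_n ≥ ρ`
  have h1 : Kn * ((geo9K i).len a ^ 2)⁻¹ * Real.exp (-(an * δ₀ * (geo9K i).dist a y)) ≤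
      Kn * ((geo9K i).len a ^ 2)⁻¹ * Real.exp (-(ρ * δ₀ * (geo9K i).dist a y)) :=
    mul_le_mul_of_nonneg_left (exp_rate_mono hρn hδ₀ hd) (mul_nonneg hKn hℓ)
  -- far terms: drop the row indicator
  have h2 : (if a ∈ SQT i c then (1 : ℝ) else 0) *
        ((KP * Real.exp (-(asep * δ₀ * DsepT i))) * ((geo9K i).len a ^ 2)⁻¹ * Real.exp (-(ρ * δ₀ * (geo9K i).dist a y))) ≤
      (KP * Real.exp (-(asep * δ₀ * DsepT i))) * ((geo9K i).len a ^ 2)⁻¹ * Real.exp (-(ρ * δ₀ * (geo9K i).dist a y)) := by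
    calc _ ≤ 1 * ((KP * Real.exp (-(asep * δ₀ * DsepT i))) * ((geo9K i).len a ^ 2)⁻¹ * Real.exp (-(ρ * δ₀ * (geo9K i).dist a y))) :=
          mul_le_mul_of_nonneg_right hind (mul_nonneg (mul_nonneg (mul_nonneg hKP hS) hℓ) hE)
      _ = _ := one_mul _
  have h3 : (if a ∈ SQT i c then (1 : ℝ) else 0) *
        (((M₂ * ∑ j, ‖b j‖) ^ 2 * (KC * B6.c1 dB δP α) * Real.exp (-(asep * δ₀ * DsepT i))) * ((geo9K i).len a ^ 2)⁻¹ *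
          Real.exp (-(ρ * δ₀ * (geo9K i).dist a y))) ≤
      ((M₂ * ∑ j, ‖b j‖) ^ 2 * (KC * B6.c1 dB δP α) * Real.exp (-(asep * δ₀ * DsepT i))) * ((geo9K i).len a ^ 2)⁻¹ *
        Real.exp (-(ρ * δ₀ * (geo9K i).dist a y)) := by
    calc _ ≤ 1 * (((M₂ * ∑ j, ‖b j‖) ^ 2 * (KC * B6.c1 dB δP α) * Real.exp (-(asep * δ₀ * DsepT i))) * ((geo9K i).len a ^ 2)⁻¹ *
          Real.exp (-(ρ * δ₀ * (geo9K i).dist a y))) :=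
          mul_le_mul_of_nonneg_right hind (mul_nonneg (mul_nonneg (mul_nonneg (mul_nonneg hSb hκC) hS) hℓ) hE)
      _ = _ := one_mul _
  calc _ ≤ Kn * ((geo9K i).len a ^ 2)⁻¹ * Real.exp (-(ρ * δ₀ * (geo9K i).dist a y)) +
        ((KP * Real.exp (-(asep * δ₀ * DsepT i))) * ((geo9K i).len a ^ 2)⁻¹ * Real.exp (-(ρ * δ₀ * (geo9K i).dist a y)) +
          ((M₂ * ∑ j, ‖b j‖) ^ 2 * (KC * B6.c1 dB δP α) * Real.exp (-(asep * δ₀ * DsepT i))) * ((geo9K i).len a ^ 2)⁻¹ *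
            Real.exp (-(ρ * δ₀ * (geo9K i).dist a y))) := add_le_add h1 (add_le_add h2 h3)
    _ = _ := by ring

/-- ★★ **THE SAME AT THE GAUGED-BACK FIELD**: for a gauge-law `parS`, `Pl_□ = DP_□D*(Ṽ^{u⁻¹})` (F3-A `locProjBY_eq_DPDsCubeY`), so `hasMajorant_famThreeT_located` reads with
`DPDsCubeY i □ parS (gaugeY i u⁻¹ Ṽ)` in place of `locProjBY □ parS u Ṽ` — the letter p33's F3-B Member §5 is stated in (its `V′`, with the window hypotheses on `V′`).
[cite: Balaban1985BackgroundPropagators, (3.105) p.414, (3.33)–(3.34) p.396, Cor. 3.6 p.408, p.415 l.18–37; Balaban1984PropagatorsII, (2.51)–(2.55) p.232, Lemma 2.1 (2.61) p.234] -/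
theorem hasMajorant_famThreeT_located_gauge {M₂ : ℝ} (hM₂ : 0 ≤ M₂) (hrepr : ∀ (v : 𝔸) (j : ι), |b.repr v j| ≤ M₂ * ‖v‖)
    {parS : SiteParY 𝔸 i} (hS : IsGaugeLawS i parS) (u : GaugeY 𝔸 i) (hu : ∀ x, ‖((u x : 𝔸ˣ) : 𝔸)‖ ≤ 1 ∧ ‖(((u x)⁻¹ : 𝔸ˣ) : 𝔸)‖ ≤ 1) (V : CfgY 𝔸 i)
    (ιB : BlkY i → IBondY i) (hι : ∀ s, β i.hN i.D i.hk (ιB s) = s) (Rr : ℝ) (H : Prop) [Fintype (geo9K i).Site] (Rr' : ℝ) (Hp : Prop)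
    (P : (FBondY i → 𝔸) →ₗ[ℂ] (FBondY i → 𝔸)) (dB : ℕ) {δ₀ an aP asep ρ Kn KP KC δP α : ℝ}
    (hδ₀ : 0 ≤ δ₀) (hKn : 0 ≤ Kn) (hKP : 0 ≤ KP) (hKC : 0 ≤ KC) (hδP : 0 ≤ δP) (hα1 : α ≤ 1) (hasep : 0 ≤ asep)
    (hρn : ρ ≤ an) (hsplitP : asep + ρ ≤ aP) (hsplitC : asep * δ₀ + ρ * δ₀ ≤ (1 - α) * δP)
    (h261C : Ineq261 dB (toB6 (geoCK i c) Rr H) δP α)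
    (hXn : HasMajorant (g := toB6 (geo9K i) Rr' Hp) (fun p : FBondY i × ι => ιB (blkV1 i.hN i.D p.1))
      (conj b ((cutMulY (𝔸 := 𝔸) (hBdY i (hTY i c)) * (P - DPDsCubeY i c parS (gaugeY i u⁻¹ V)) *
        cutMulY (𝔸 := 𝔸) (hBdY i (zetaY i c))).restrictScalars ℝ))
      (fun a y => Kn * ((geo9K i).len a ^ 2)⁻¹ * Real.exp (-(an * δ₀ * (geo9K i).dist a y))))
    (hP : HasMajorant (g := toB6 (geo9K i) Rr' Hp) (fun p : FBondY i × ι => ιB (blkV1 i.hN i.D p.1)) (conj b (P.restrictScalars ℝ))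
      (fun a y => KP * ((geo9K i).len a ^ 2)⁻¹ * Real.exp (-(aP * δ₀ * (geo9K i).dist a y))))
    (hPlC : HasMajorant (g := toB6 (geoCK i c) Rr H) (blkBK i c) (conj b ((DPDsCubeY i c parS V).restrictScalars ℝ))
      (fun a s => KC * ((geoCK i c).len a ^ 2)⁻¹ * Real.exp (-(δP * (geoCK i c).dist a s)))) :
    HasMajorant (g := toB6 (geo9K i) Rr' Hp) (fun p : FBondY i × ι => ιB (blkV1 i.hN i.D p.1))
      (conj b ((cutMulY (𝔸 := 𝔸) (hBdY i (hTY i c)) * (P - DPDsCubeY i c parS (gaugeY i u⁻¹ V))).restrictScalars ℝ))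
      (fun a y => (Kn + (KP + (M₂ * ∑ j, ‖b j‖) ^ 2 * (KC * B6.c1 dB δP α)) * Real.exp (-(asep * δ₀ * DsepT i))) *
        ((geo9K i).len a ^ 2)⁻¹ * Real.exp (-(ρ * δ₀ * (geo9K i).dist a y))) := by
  rw [← locProjBY_eq_DPDsCubeY i c hS u V] at hXn ⊢
  exact hasMajorant_famThreeT_located i c b hM₂ hrepr parS u hu V ιB hι Rr H Rr' Hp P dB hδ₀ hKn hKP hKC hδP hα1 hasep hρn hsplitP hsplitC
    h261C hXn hP hPlC

end Located

end Literature.MathematicalPhysics.QuantumFieldTheory.Balaban1983to89.B9Eq3105FamThreeTFar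

end
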